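import Summits.QuantumFields.QCD.Theses.SpectralDefectExtinction
import Literature.MathematicalPhysics.QuantumFieldTheory.QCDPhaseQuenched
import Literature.MathematicalPhysics.QuantumFieldTheory.SpectralDefectDensity
import Literature.Barriers.QuantumFields.WilsonDeterminantMassSplitting

/-!
# Bridge lemma J toward stub `coareaWegner` of line `Sketch` (skeleton "ResolventCell", gen 2) for
crux `SpectralDefectExtinction.WegnerEstimate` (item stmt-QuantumFields-8966):
the 1-D area / Banach-indicatrix INEQUALITY for Lipschitz functions

The analytic heart of the 1-D route (Lines/Sketch.md §gen 2, step (AREA)) is, for each sorted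
eigenvalue `t ↦ Λ(t)` along a one-link circle (Lipschitz by Weyl, NOT `C¹`, possibly nowhere simple),
the bound `∫ |Λ'(t)| φ_ε(Λ(t)) dt ≤ ∫ φ_ε(E) · N_Λ(E) dE`, `N_Λ(E) = #{t : Λ(t) = E}` (counted with the
later multiplicity bookkeeping).  This file proves it for an arbitrary Lipschitz `h : ℝ → ℝ` and a
continuous weight `φ ≥ 0`, with no monotonicity, no `C¹` hypothesis and no decomposition into
monotone pieces (Federer 3.2.3 is the equality; only `≤` is needed):

  `∫⁻_{[a,b]} |h'| · φ∘h ≤ 2 · ∫⁻ φ(E) · #{s ∈ [a, b + δ] : h s = E} dE`   (`δ > 0` arbitrary)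

(`coareaWegner_lintegral_deriv_mul_le_crossings`).  Proof: with `Φ' = φ`, a.e. (Lebesgue/Rademacher)
`|h'| φ∘h = |(Φ∘h)'| = lim_n n |Φ(h(t + 1/n)) − Φ(h(t))|`, so by FATOU the left side is at most
`liminf_n ∫_{[a,b]} n |Φ(h(t + 1/n)) − Φ(h(t))| dt`; rearranging the shifted difference quotient over the
translates `a + s + k/n` (`s ∈ (0, 1/n]`) turns this integral into an average over `s` of `n` times the
VARIATION SUMS `Σ_k |Φ(h(t_{k+1})) − Φ(h(t_k))|` of `Φ∘h` along the partitions `t_k = a + s + k/n`, and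
each variation sum is at most `2 ∫ φ(E) #{s : h s = E} dE` by the INTERMEDIATE VALUE THEOREM
(`|Φ(h(t')) − Φ(h(t))| = |∫_{h t}^{h t'} φ| ≤ ∫_{h([t,t'])} φ`, and every level `E` is met by at most
`#{s ∈ [t_k, t_{k+1}) : h s = E} + [h(t_{k+1}) = E]` of the pieces).  The factor `2` (shared endpoints)
is harmless downstream.
-/

noncomputable section

namespace Summit.QuantumFields.QCD.Cruxes.WegnerEstimate.ResolventCell

open MeasureTheory Filter Set
open scoped BigOperators ENNReal NNReal Topology

/-! ### Step A: one increment of `Φ ∘ h` is bounded by the `φ`-measure of the image -/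

/-- For continuous `h`, continuous `φ ≥ 0` and `Φ` with `Φ y₂ − Φ y₁ = ∫_{y₁}^{y₂} φ`:
`|Φ(h t') − Φ(h t)| ≤ ∫⁻_{h([t,t'])} φ` for `t ≤ t'` (intermediate value theorem). -/
theorem coareaWegner_ofReal_abs_sub_le_lintegral_image {h φ : ℝ → ℝ} (hh : Continuous h)
    (hφ : Continuous φ) (hφ0 : ∀ x, 0 ≤ φ x) (Φ : ℝ → ℝ)
    (hΦ : ∀ y₁ y₂, Φ y₂ - Φ y₁ = ∫ x in y₁..y₂, φ x) {t t' : ℝ} (htt' : t ≤ t') :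
    ENNReal.ofReal |Φ (h t') - Φ (h t)| ≤ ∫⁻ E in h '' Set.Icc t t', ENNReal.ofReal (φ E) := by
  rw [hΦ, intervalIntegral.abs_integral_eq_abs_integral_uIoc]
  have hint : IntegrableOn φ (Set.uIoc (h t) (h t')) volume :=
    (hφ.integrableOn_Icc (a := min (h t) (h t')) (b := max (h t) (h t'))).mono_set
      Set.uIoc_subset_uIcc
  have hnn : 0 ≤ᵐ[volume.restrict (Set.uIoc (h t) (h t'))] φ :=
    Filter.Eventually.of_forall hφ0
  rw [abs_of_nonneg (integral_nonneg_of_ae hnn), ofReal_integral_eq_lintegral_ofReal hint hnn]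
  refine lintegral_mono_set (Set.uIoc_subset_uIcc.trans ?_)
  have hiv := intermediate_value_uIcc (a := t) (b := t') hh.continuousOn
  rwa [Set.uIcc_of_le htt'] at hiv

/-! ### Step B: variation sums along a uniform partition are bounded by the crossing counts -/

open scoped Classical in
/-- Counting: along the partition `t_k = c + k/n` (`n > 0`), the number of pieces `[t_k, t_{k+1}]`,
`k < K`, whose image under `h` contains the level `E` is at most twice the number of solutions of
`h s = E` in `[t_0, t_K]` (each such piece has a solution in `[t_k, t_{k+1})` or at `t_{k+1}`). -/
theorem coareaWegner_card_pieces_le_two_mul_encard (h : ℝ → ℝ) (c : ℝ) {n : ℕ} (hn : 0 < n) (K : ℕ)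
    (E : ℝ) :
    ((((Finset.range K).filter fun k : ℕ =>
        E ∈ h '' Set.Icc (c + k / n) (c + (k + 1) / n)).card : ℕ∞) : ℝ≥0∞) ≤
      2 * (({s : ℝ | s ∈ Set.Icc c (c + K / n) ∧ h s = E}.encard : ℕ∞) : ℝ≥0∞) := by
  have hn' : (0 : ℝ) < n := Nat.cast_pos.2 hn
  set T : Set ℝ := {s : ℝ | s ∈ Set.Icc c (c + K / n) ∧ h s = E} with hT
  set F := (Finset.range K).filter fun k : ℕ => E ∈ h '' Set.Icc (c + k / n) (c + (k + 1) / n) with hF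
  set F₁ := (Finset.range K).filter fun k : ℕ =>
    ∃ s ∈ Set.Ico (c + k / n) (c + (k + 1) / n), h s = E with hF₁
  set F₂ := (Finset.range K).filter fun k : ℕ => h (c + (k + 1) / n) = E with hF₂
  -- pieces inside `[t_0, t_K]`
  have hpiece : ∀ k : ℕ, k < K → Set.Icc (c + k / n) (c + (k + 1) / n) ⊆ Set.Icc c (c + K / n) := by
    intro k hk s hs
    constructor
    · exact le_trans (by simp only [le_add_iff_nonneg_right]; positivity) hs.1
    · refine hs.2.trans ?_
      have : ((k : ℝ) + 1) / n ≤ (K : ℝ) / n := by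
        apply div_le_div_of_nonneg_right _ hn'.le
        exact_mod_cast hk
      linarith
  -- `F ⊆ F₁ ∪ F₂`
  have hsub : F ⊆ F₁ ∪ F₂ := by
    intro k hk
    rw [hF, Finset.mem_filter] at hk
    obtain ⟨hkK, s, hs, hsE⟩ := hk
    rw [Finset.mem_union, hF₁, hF₂, Finset.mem_filter, Finset.mem_filter]
    rcases hs.2.lt_or_eq with hlt | heq
    · exact Or.inl ⟨hkK, s, ⟨hs.1, hlt⟩, hsE⟩
    · exact Or.inr ⟨hkK, heq ▸ hsE⟩
  -- `#F₁ ≤ #T`: pick a solution in each half-open piece; the pieces are disjoint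
  have h1 : ((F₁.card : ℕ∞) : ℝ≥0∞) ≤ ((T.encard : ℕ∞) : ℝ≥0∞) := by
    set sel : ℕ → ℝ := fun k =>
      if hk : ∃ s ∈ Set.Ico (c + k / n) (c + (k + 1) / n), h s = E then Classical.choose hk else 0
      with hsel
    have hsel_spec : ∀ k ∈ F₁, sel k ∈ Set.Ico (c + k / n) (c + (k + 1) / n) ∧ h (sel k) = E := by
      intro k hk
      rw [hF₁, Finset.mem_filter] at hk
      simp only [hsel, dif_pos hk.2]
      exact Classical.choose_spec hk.2
    have hinj : Set.InjOn sel (F₁ : Set ℕ) := by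
      intro k hk k' hk' hkk'
      have a := (hsel_spec k hk).1
      have b := (hsel_spec k' hk').1
      rw [hkk'] at a
      -- `sel k'` lies in both pieces `k` and `k'`
      by_contra hne
      rcases lt_or_gt_of_ne hne with hlt | hlt
      · have : ((k : ℝ) + 1) / n ≤ (k' : ℝ) / n := by
          apply div_le_div_of_nonneg_right _ hn'.le
          exact_mod_cast hlt
        linarith [a.2, b.1]
      · have : ((k' : ℝ) + 1) / n ≤ (k : ℝ) / n := by
          apply div_le_div_of_nonneg_right _ hn'.le
          exact_mod_cast hlt
        linarith [a.1, b.2]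
    have himg : sel '' (F₁ : Set ℕ) ⊆ T := by
      rintro _ ⟨k, hk, rfl⟩
      have hk' : k < K := by
        have := hk
        rw [Finset.mem_coe, hF₁, Finset.mem_filter, Finset.mem_range] at this
        exact this.1
      obtain ⟨hmem, hval⟩ := hsel_spec k hk
      exact ⟨hpiece k hk' (Set.Ico_subset_Icc_self hmem), hval⟩
    have := Set.encard_le_encard himg
    rw [hinj.encard_image, Set.encard_coe_eq_coe_finsetCard] at this
    exact ENat.toENNReal_le.2 this
  -- `#F₂ ≤ #T`: the right endpoints are distinct solutions
  have h2 : ((F₂.card : ℕ∞) : ℝ≥0∞) ≤ ((T.encard : ℕ∞) : ℝ≥0∞) := by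
    set sel : ℕ → ℝ := fun k => c + ((k : ℝ) + 1) / n with hsel
    have hinj : Set.InjOn sel (F₂ : Set ℕ) := by
      intro k _ k' _ hkk'
      simp only [hsel, add_right_inj] at hkk'
      rw [div_left_inj' hn'.ne'] at hkk'
      exact_mod_cast (add_right_cancel hkk' : (k : ℝ) = k')
    have himg : sel '' (F₂ : Set ℕ) ⊆ T := by
      rintro _ ⟨k, hk, rfl⟩
      rw [Finset.mem_coe, hF₂, Finset.mem_filter, Finset.mem_range] at hk
      refine ⟨hpiece k hk.1 ⟨?_, le_rfl⟩, hk.2⟩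
      simp only [hsel, add_le_add_iff_left]
      exact div_le_div_of_nonneg_right (by linarith) hn'.le
    have := Set.encard_le_encard himg
    rw [hinj.encard_image, Set.encard_coe_eq_coe_finsetCard] at this
    exact ENat.toENNReal_le.2 this
  calc ((F.card : ℕ∞) : ℝ≥0∞) ≤ (((F₁ ∪ F₂).card : ℕ∞) : ℝ≥0∞) := by
        exact_mod_cast Finset.card_le_card hsub
    _ ≤ ((F₁.card : ℕ∞) : ℝ≥0∞) + ((F₂.card : ℕ∞) : ℝ≥0∞) := by
        exact_mod_cast Finset.card_union_le F₁ F₂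
    _ ≤ ((T.encard : ℕ∞) : ℝ≥0∞) + ((T.encard : ℕ∞) : ℝ≥0∞) := add_le_add h1 h2
    _ = 2 * ((T.encard : ℕ∞) : ℝ≥0∞) := by rw [two_mul]

/-- **Variation sums are bounded by crossing counts.**  Along `t_k = c + k/n`,
`Σ_{k<K} |Φ(h t_{k+1}) − Φ(h t_k)| ≤ 2 ∫⁻ φ(E) · #{s ∈ [t_0, t_K] : h s = E} dE`. -/
theorem coareaWegner_variation_sum_le {h φ : ℝ → ℝ} (hh : Continuous h) (hφ : Continuous φ)
    (hφ0 : ∀ x, 0 ≤ φ x) (Φ : ℝ → ℝ) (hΦ : ∀ y₁ y₂, Φ y₂ - Φ y₁ = ∫ x in y₁..y₂, φ x) (c : ℝ)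
    {n : ℕ} (hn : 0 < n) (K : ℕ) :
    ∑ k ∈ Finset.range K, ENNReal.ofReal |Φ (h (c + (k + 1) / n)) - Φ (h (c + k / n))| ≤
      2 * ∫⁻ E, ENNReal.ofReal (φ E) *
        (({s : ℝ | s ∈ Set.Icc c (c + K / n) ∧ h s = E}.encard : ℕ∞) : ℝ≥0∞) := by
  classical
  have hn' : (0 : ℝ) < n := Nat.cast_pos.2 hn
  set S : ℕ → Set ℝ := fun k => h '' Set.Icc (c + k / n) (c + (k + 1) / n) with hS
  have hSm : ∀ k, MeasurableSet (S k) := fun k =>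
    ((isCompact_Icc.image hh).isClosed).measurableSet
  have hle : ∀ k, c + (k : ℝ) / n ≤ c + ((k : ℝ) + 1) / n := fun k => by
    simp only [add_le_add_iff_left]
    exact div_le_div_of_nonneg_right (by linarith) hn'.le
  calc ∑ k ∈ Finset.range K, ENNReal.ofReal |Φ (h (c + (k + 1) / n)) - Φ (h (c + k / n))|
      ≤ ∑ k ∈ Finset.range K, ∫⁻ E in S k, ENNReal.ofReal (φ E) :=
        Finset.sum_le_sum fun k _ =>
          coareaWegner_ofReal_abs_sub_le_lintegral_image hh hφ hφ0 Φ hΦ (hle k)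
    _ = ∑ k ∈ Finset.range K, ∫⁻ E, (S k).indicator (fun E => ENNReal.ofReal (φ E)) E :=
        Finset.sum_congr rfl fun k _ => (lintegral_indicator (hSm k) _).symm
    _ = ∫⁻ E, ∑ k ∈ Finset.range K, (S k).indicator (fun E => ENNReal.ofReal (φ E)) E := by
        rw [lintegral_finsetSum]
        exact fun k _ => (ENNReal.measurable_ofReal.comp hφ.measurable).indicator (hSm k)
    _ = ∫⁻ E, ENNReal.ofReal (φ E) *
          ((((Finset.range K).filter fun k : ℕ => E ∈ S k).card : ℕ∞) : ℝ≥0∞) := by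
        refine lintegral_congr fun E => ?_
        have : ∀ k, (S k).indicator (fun E => ENNReal.ofReal (φ E)) E =
            ENNReal.ofReal (φ E) * (if E ∈ S k then 1 else 0) := by
          intro k
          by_cases hE : E ∈ S k <;> simp [hE]
        simp_rw [this]
        rw [← Finset.mul_sum, Finset.sum_boole, ENat.toENNReal_coe]
    _ ≤ ∫⁻ E, ENNReal.ofReal (φ E) *
          (2 * (({s : ℝ | s ∈ Set.Icc c (c + K / n) ∧ h s = E}.encard : ℕ∞) : ℝ≥0∞)) :=
        lintegral_mono fun E => mul_le_mul' le_rfl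
          (coareaWegner_card_pieces_le_two_mul_encard h c hn K E)
    _ = 2 * ∫⁻ E, ENNReal.ofReal (φ E) *
          (({s : ℝ | s ∈ Set.Icc c (c + K / n) ∧ h s = E}.encard : ℕ∞) : ℝ≥0∞) := by
        rw [← lintegral_const_mul' _ _ ENNReal.ofNat_ne_top]
        refine lintegral_congr fun E => ?_
        ring

/-! ### Step C: the shifted difference quotient, integrated, is an average of variation sums -/

/-- Adjacent pieces: `∫⁻_{(a, a + K/n]} G = Σ_{k<K} ∫⁻_{(a + k/n, a + (k+1)/n]} G`. -/
theorem coareaWegner_lintegral_Ioc_eq_sum (G : ℝ → ℝ≥0∞) (a : ℝ) {n : ℕ} (hn : 0 < n) (K : ℕ) :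
    ∫⁻ t in Set.Ioc a (a + K / n), G t =
      ∑ k ∈ Finset.range K, ∫⁻ t in Set.Ioc (a + k / n) (a + (k + 1) / n), G t := by
  have hn' : (0 : ℝ) < n := Nat.cast_pos.2 hn
  induction K with
  | zero => simp
  | succ K ih =>
    rw [Finset.sum_range_succ, ← ih]
    have h₁ : a ≤ a + (K : ℝ) / n := by simp only [le_add_iff_nonneg_right]; positivity
    have h₂ : a + (K : ℝ) / n ≤ a + ((K : ℝ) + 1) / n := by
      simp only [add_le_add_iff_left]
      exact div_le_div_of_nonneg_right (by linarith) hn'.le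
    have hunion : Set.Ioc a (a + ((K : ℝ) + 1) / n) =
        Set.Ioc a (a + K / n) ∪ Set.Ioc (a + K / n) (a + ((K : ℝ) + 1) / n) :=
      (Set.Ioc_union_Ioc_eq_Ioc h₁ h₂).symm
    have hdisj : Disjoint (Set.Ioc a (a + K / n)) (Set.Ioc (a + K / n) (a + ((K : ℝ) + 1) / n)) :=
      Set.Ioc_disjoint_Ioc.2 ((min_le_left _ _).trans (le_max_right _ _))
    push_cast
    rw [hunion, lintegral_union measurableSet_Ioc hdisj]

/-- Translation: `∫⁻_{(α, α + L]} G = ∫⁻_{(0, L]} G(α + s) ds`. -/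
theorem coareaWegner_lintegral_Ioc_shift (G : ℝ → ℝ≥0∞) (α L : ℝ) :
    ∫⁻ t in Set.Ioc α (α + L), G t = ∫⁻ s in Set.Ioc 0 L, G (α + s) := by
  have hind : ∀ s, (Set.Ioc α (α + L)).indicator G (s + α) =
      (Set.Ioc 0 L).indicator (fun s => G (α + s)) s := by
    intro s
    by_cases hs : s ∈ Set.Ioc 0 L
    · rw [Set.indicator_of_mem hs, Set.indicator_of_mem, add_comm]
      exact ⟨by linarith [hs.1], by linarith [hs.2]⟩
    · rw [Set.indicator_of_notMem hs, Set.indicator_of_notMem]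
      intro h
      exact hs ⟨by linarith [h.1], by linarith [h.2]⟩
  calc ∫⁻ t in Set.Ioc α (α + L), G t = ∫⁻ t, (Set.Ioc α (α + L)).indicator G t :=
        (lintegral_indicator measurableSet_Ioc _).symm
    _ = ∫⁻ s, (Set.Ioc α (α + L)).indicator G (s + α) := (lintegral_add_right_eq_self _ α).symm
    _ = ∫⁻ s, (Set.Ioc 0 L).indicator (fun s => G (α + s)) s := lintegral_congr hind
    _ = ∫⁻ s in Set.Ioc 0 L, G (α + s) := lintegral_indicator measurableSet_Ioc _

/-- **The integrated shifted difference quotient is bounded by the crossing counts.**  For continuous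
`h`, continuous `φ ≥ 0`, `Φ` with `Φ y₂ − Φ y₁ = ∫_{y₁}^{y₂} φ`, `a ≤ b`, `δ > 0` and `n ≥ 2/δ`:
`∫⁻_{[a,b]} n |Φ(h(t + 1/n)) − Φ(h t)| dt ≤ 2 ∫⁻ φ(E) · #{s ∈ [a, b + δ] : h s = E} dE`. -/
theorem coareaWegner_lintegral_shiftQuotient_le {h φ : ℝ → ℝ} (hh : Continuous h) (hφ : Continuous φ)
    (hφ0 : ∀ x, 0 ≤ φ x) (Φ : ℝ → ℝ) (hΦ : ∀ y₁ y₂, Φ y₂ - Φ y₁ = ∫ x in y₁..y₂, φ x)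
    (hΦc : Continuous Φ) {a b δ : ℝ} (hab : a ≤ b) {n : ℕ} (hn : 0 < n) (hnδ : 2 / δ ≤ n)
    (hδ : 0 < δ) :
    ∫⁻ t in Set.Icc a b, ENNReal.ofReal (n * |Φ (h (t + 1 / n)) - Φ (h t)|) ≤
      2 * ∫⁻ E, ENNReal.ofReal (φ E) *
        (({s : ℝ | s ∈ Set.Icc a (b + δ) ∧ h s = E}.encard : ℕ∞) : ℝ≥0∞) := by
  have hn' : (0 : ℝ) < n := Nat.cast_pos.2 hn
  set I : ℝ≥0∞ := ∫⁻ E, ENNReal.ofReal (φ E) *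
    (({s : ℝ | s ∈ Set.Icc a (b + δ) ∧ h s = E}.encard : ℕ∞) : ℝ≥0∞) with hI
  set G : ℝ → ℝ≥0∞ := fun t => ENNReal.ofReal (n * |Φ (h (t + 1 / n)) - Φ (h t)|) with hG
  have hGm : Measurable G :=
    ENNReal.measurable_ofReal.comp (continuous_const.mul
      ((hΦc.comp (hh.comp (continuous_id.add continuous_const))).sub (hΦc.comp hh)).abs).measurable
  -- the number of pieces
  set K : ℕ := ⌈(b - a) * n⌉₊ with hK
  have hK1 : b ≤ a + K / n := by
    have h1 : (b - a) * n ≤ K := Nat.le_ceil _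
    rw [← sub_le_iff_le_add', le_div_iff₀ hn']
    exact h1
  have hK2 : (K : ℝ) / n ≤ b - a + 1 / n := by
    have h1 : (K : ℝ) < (b - a) * n + 1 := Nat.ceil_lt_add_one (mul_nonneg (sub_nonneg.2 hab) hn'.le)
    rw [div_le_iff₀ hn', add_mul, one_div_mul_cancel hn'.ne']
    exact h1.le
  have h2n : 2 / (n : ℝ) ≤ δ := by
    rw [div_le_iff₀ hn']
    rw [div_le_iff₀ hδ] at hnδ
    linarith
  -- pointwise bound on the rearranged integrand
  have hpt : ∀ s ∈ Set.Ioc (0 : ℝ) (1 / n),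
      ∑ k ∈ Finset.range K, G (a + k / n + s) ≤ ENNReal.ofReal n * (2 * I) := by
    intro s hs
    have harg : ∀ k : ℕ, G (a + k / n + s) =
        ENNReal.ofReal n * ENNReal.ofReal |Φ (h ((a + s) + (k + 1) / n)) - Φ (h ((a + s) + k / n))| := by
      intro k
      have e1 : a + (k : ℝ) / n + s + 1 / n = (a + s) + ((k : ℝ) + 1) / n := by ring
      have e2 : a + (k : ℝ) / n + s = (a + s) + (k : ℝ) / n := by ring
      show ENNReal.ofReal (n * |Φ (h (a + k / n + s + 1 / n)) - Φ (h (a + k / n + s))|) = _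
      rw [e1, e2, ENNReal.ofReal_mul hn'.le]
    simp_rw [harg]
    rw [← Finset.mul_sum]
    refine mul_le_mul' le_rfl ?_
    refine (coareaWegner_variation_sum_le hh hφ hφ0 Φ hΦ (a + s) hn K).trans ?_
    refine mul_le_mul' le_rfl (lintegral_mono fun E => mul_le_mul' le_rfl ?_)
    refine ENat.toENNReal_le.2 (Set.encard_le_encard ?_)
    rintro u ⟨hu, huE⟩
    have h22 : (2 : ℝ) / n = 1 / n + 1 / n := by ring
    refine ⟨⟨?_, ?_⟩, huE⟩
    · linarith [hu.1, hs.1]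
    · linarith [hu.2, hs.2, hK2, h2n, h22]
  calc ∫⁻ t in Set.Icc a b, G t = ∫⁻ t in Set.Ioc a b, G t := setLIntegral_congr Ioc_ae_eq_Icc.symm
    _ ≤ ∫⁻ t in Set.Ioc a (a + K / n), G t := lintegral_mono_set (Set.Ioc_subset_Ioc_right hK1)
    _ = ∑ k ∈ Finset.range K, ∫⁻ t in Set.Ioc (a + k / n) (a + (k + 1) / n), G t :=
        coareaWegner_lintegral_Ioc_eq_sum G a hn K
    _ = ∑ k ∈ Finset.range K, ∫⁻ s in Set.Ioc (0 : ℝ) (1 / n), G (a + k / n + s) := by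
        refine Finset.sum_congr rfl fun k _ => ?_
        have : a + ((k : ℝ) + 1) / n = (a + k / n) + 1 / n := by ring
        rw [this]
        exact coareaWegner_lintegral_Ioc_shift G _ _
    _ = ∫⁻ s in Set.Ioc (0 : ℝ) (1 / n), ∑ k ∈ Finset.range K, G (a + k / n + s) := by
        rw [lintegral_finsetSum]
        exact fun k _ => hGm.comp (measurable_const_add _)
    _ ≤ ∫⁻ s in Set.Ioc (0 : ℝ) (1 / n), ENNReal.ofReal n * (2 * I) :=
        setLIntegral_mono' measurableSet_Ioc hpt
    _ = ENNReal.ofReal n * (2 * I) * volume (Set.Ioc (0 : ℝ) (1 / n)) := setLIntegral_const _ _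
    _ = 2 * I := by
        rw [Real.volume_Ioc, sub_zero, mul_comm, ← mul_assoc, ← ENNReal.ofReal_mul (by positivity),
          one_div_mul_cancel hn'.ne', ENNReal.ofReal_one, one_mul]

/-! ### Step D: Fatou -/

/-- **1-D area inequality / Banach indicatrix bound for Lipschitz functions.**  For a Lipschitz
`h : ℝ → ℝ`, a continuous weight `φ ≥ 0`, `a ≤ b` and any `δ > 0`:
`∫⁻_{[a,b]} |h'(t)| φ(h(t)) dt ≤ 2 ∫⁻ φ(E) · #{s ∈ [a, b + δ] : h(s) = E} dE`
(`h' = deriv h`, defined a.e. by Lebesgue's theorem; the count is `Set.encard`, possibly infinite).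
Fatou over the shifted difference quotients of `Φ ∘ h`, `Φ' = φ`, and the variation-sum bound. -/
theorem coareaWegner_lintegral_deriv_mul_le_crossings {h : ℝ → ℝ} {K : NNReal} (hh : LipschitzWith K h)
    {φ : ℝ → ℝ} (hφ : Continuous φ) (hφ0 : ∀ x, 0 ≤ φ x) {a b δ : ℝ} (hab : a ≤ b) (hδ : 0 < δ) :
    ∫⁻ t in Set.Icc a b, ENNReal.ofReal (|deriv h t| * φ (h t)) ≤
      2 * ∫⁻ E, ENNReal.ofReal (φ E) *
        (({s : ℝ | s ∈ Set.Icc a (b + δ) ∧ h s = E}.encard : ENat) : ENNReal) := by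
  have hhc : Continuous h := hh.continuous
  -- the primitive of `φ`
  set Φ : ℝ → ℝ := fun y => ∫ x in (0 : ℝ)..y, φ x with hΦdef
  have hΦd : ∀ y, HasDerivAt Φ (φ y) y := fun y => (hφ.integral_hasStrictDerivAt 0 y).hasDerivAt
  have hΦc : Continuous Φ := continuous_iff_continuousAt.2 fun y => (hΦd y).continuousAt
  have hΦ : ∀ y₁ y₂, Φ y₂ - Φ y₁ = ∫ x in y₁..y₂, φ x := fun y₁ y₂ =>
    intervalIntegral.integral_interval_sub_left (hφ.intervalIntegrable _ _) (hφ.intervalIntegrable _ _)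
  -- the shifted difference quotients
  set F : ℕ → ℝ → ℝ≥0∞ := fun n t => ENNReal.ofReal (n * |Φ (h (t + 1 / n)) - Φ (h t)|) with hF
  have hFm : ∀ n, Measurable (F n) := fun n =>
    ENNReal.measurable_ofReal.comp (continuous_const.mul
      ((hΦc.comp (hhc.comp (continuous_id.add continuous_const))).sub (hΦc.comp hhc)).abs).measurable
  -- a.e. the integrand is the limit of the difference quotients
  have hae : ∀ᵐ t ∂(volume.restrict (Set.Icc a b)),
      ENNReal.ofReal (|deriv h t| * φ (h t)) = liminf (fun n => F n t) atTop := by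
    refine ae_restrict_of_ae ?_
    filter_upwards [hh.ae_differentiableAt_real] with t ht
    have hG : HasDerivAt (fun s => Φ (h s)) (φ (h t) * deriv h t) t := (hΦd (h t)).comp t ht.hasDerivAt
    have hu : Tendsto (fun n : ℕ => t + 1 / (n : ℝ)) atTop (𝓝[≠] t) := by
      refine tendsto_nhdsWithin_iff.2 ⟨?_, ?_⟩
      · have h0 : Tendsto (fun n : ℕ => 1 / (n : ℝ)) atTop (𝓝 0) := tendsto_one_div_atTop_nhds_zero_nat
        simpa using tendsto_const_nhds.add h0
      · filter_upwards [eventually_gt_atTop 0] with n hn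
        rw [Set.mem_compl_singleton_iff]
        have : (0 : ℝ) < 1 / n := by positivity
        linarith
    have h1 : Tendsto (fun n : ℕ => slope (fun s => Φ (h s)) t (t + 1 / (n : ℝ))) atTop
        (𝓝 (φ (h t) * deriv h t)) := (hasDerivAt_iff_tendsto_slope.1 hG).comp hu
    have h2 : ∀ᶠ n : ℕ in atTop, slope (fun s => Φ (h s)) t (t + 1 / (n : ℝ)) =
        (n : ℝ) * (Φ (h (t + 1 / n)) - Φ (h t)) := by
      filter_upwards [eventually_gt_atTop 0] with n hn
      have hn' : (0 : ℝ) < n := Nat.cast_pos.2 hn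
      rw [slope_def_field, add_sub_cancel_left, div_eq_iff (by positivity), mul_comm,
        ← mul_assoc, one_div_mul_cancel hn'.ne', one_mul]
    have h3 : Tendsto (fun n : ℕ => (n : ℝ) * |Φ (h (t + 1 / n)) - Φ (h t)|) atTop
        (𝓝 (|deriv h t| * φ (h t))) := by
      have hlim0 := (h1.congr' h2).abs
      have hlim : |φ (h t) * deriv h t| = |deriv h t| * φ (h t) := by
        rw [abs_mul, abs_of_nonneg (hφ0 _), mul_comm]
      rw [hlim] at hlim0
      refine hlim0.congr fun n => ?_
      rw [abs_mul, Nat.abs_cast]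
    have h4 : Tendsto (fun n => F n t) atTop (𝓝 (ENNReal.ofReal (|deriv h t| * φ (h t)))) :=
      (ENNReal.continuous_ofReal.tendsto _).comp h3
    exact h4.liminf_eq.symm
  -- Fatou, and the uniform bound on the difference quotients
  calc ∫⁻ t in Set.Icc a b, ENNReal.ofReal (|deriv h t| * φ (h t))
      = ∫⁻ t in Set.Icc a b, liminf (fun n => F n t) atTop := lintegral_congr_ae hae
    _ ≤ liminf (fun n => ∫⁻ t in Set.Icc a b, F n t) atTop := lintegral_liminf_le fun n => hFm n
    _ ≤ 2 * ∫⁻ E, ENNReal.ofReal (φ E) *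
          (({s : ℝ | s ∈ Set.Icc a (b + δ) ∧ h s = E}.encard : ℕ∞) : ℝ≥0∞) := by
        refine liminf_le_of_frequently_le' (Filter.Eventually.frequently ?_)
        filter_upwards [eventually_ge_atTop ⌈2 / δ⌉₊, eventually_gt_atTop 0] with n hn hn0
        have hnδ : 2 / δ ≤ n := (Nat.le_ceil (2 / δ)).trans (by exact_mod_cast hn)
        exact coareaWegner_lintegral_shiftQuotient_le hhc hφ hφ0 Φ hΦ hΦc hab hn0 hnδ hδ

end Summit.QuantumFields.QCD.Cruxes.WegnerEstimate.ResolventCell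

end
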